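import Literature.MathematicalPhysics.QuantumLattice.GrassmannLaplacianTruncatedBound
import Literature.MathematicalPhysics.QuantumLattice.GrassmannDeterminantBounded
import HarnessLib

/-!
# The single-scale `L¹–L^∞` tree bound for DETERMINANT-BOUNDED covariances (twin of `GrassmannLaplacianTruncatedBound`)

Topic `MathematicalPhysics/QuantumLattice`.  `GrassmannLaplacianScriptBound` / `GrassmannLaplacianTruncatedBound` prove the `n!`-free
`L¹–L^∞` estimate of the truncated expectation of kernel vertices (Benfatto–Giuliani–Mastropietro 2006, (2.66)–(2.80)) for a charged
covariance in GRAM form.  The Gram form is consumed in exactly one place — the bound `‖∫ dμ_{C_{s,t}} ψ(Z)‖ ≤ κ^N` for the interpolated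
covariances of the scripts — and `GrassmannDeterminantBounded` isolates that consumption as the hypothesis `IsGramBounded C κ`, implied by
Gram form (`isGramBounded_of_gram`) AND by the Pedra–Salmhofer determinant bound of a chronological propagator
(`IsDetBounded.isGramBounded`), which has no Gram form with temperature-independent constants (de Siqueira Pedra–Salmhofer 2008,
Lemma 2.2 / Thm 2.4).  This file re-runs the three Gram-dependent theorems of those two files VERBATIM under `IsGramBounded`:

* `norm_kernel_treeFactor_genProd_le_of_gramBounded` (twin of `norm_kernel_treeFactor_genProd_le`),
* `sum_sum_norm_kernel_treeFactor_le_of_gramBounded` (twin of `sum_sum_norm_kernel_treeFactor_le`),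
* **`sum_norm_kernel_ursellOf_kernelVertex_le_of_gramBounded`** (twin of `sum_norm_kernel_ursellOf_kernelVertex_le`):
  `Σ_{W : W_i = w} ‖kernel_r 𝓔ᵀ_C(M_0,…,M_{n-1}) (W)‖ ≤ (r!)⁻¹ N^{(r)} κ^{N - r - 2(n-1)} (∏_v N_v) · λ^{-(n-1)} ∏_ℓ (1 + λ α m m'_ℓ)`.

The proofs are those of the Gram-form file with the single call replaced; nothing else changes.  Everything is proved; no definition,
no named fact.

## Sources

G. Benfatto, A. Giuliani, V. Mastropietro, Ann. Henri Poincaré 7 (2006) 809–898, (2.66)–(2.80) [`BenfattoGiulianiMastropietro2006`];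
W. de Siqueira Pedra, M. Salmhofer, Comm. Math. Phys. 282 (2008) 797–818, Thm 1.3, Thm 2.4 [`PedraSalmhofer2008`];
K. Gawȩdzki, A. Kupiainen, Comm. Math. Phys. 102 (1985) 1–30 [`GawedzkiKupiainen1985GrossNeveu`].
-/

noncomputable section

namespace Literature.MathematicalPhysics.QuantumLattice

open GrassmannAlgebra Finset MvPolynomial Literature.RingTheory.MvPolynomial
open Literature.Probability.LatticeModels Literature.Probability.LatticeModels.BattleFederbush
open Literature.MeasureTheory.Integral
open scoped InnerProductSpace

/-! ### One tree factor on one monomial -/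

section ScriptBound

variable {𝕜 : Type*} [RCLike 𝕜] {Γ : Type*} [Fintype Γ] [DecidableEq Γ] {ι : Type*} [Fintype ι] [DecidableEq ι]
variable (C : Matrix Γ Γ 𝕜) (cl : Γ → ι) {v : ι} {k : ℕ}

/-- (Twin of `norm_kernel_treeFactor_genProd_le` under `IsGramBounded`.) **The Gram bound for the kernels of one tree factor on one monomial** (Benfatto–Giuliani–Mastropietro 2006,
(2.66) with (2.80)): for a charged covariance in Gram form on the mixed pairs (`‖f‖, ‖g‖ ≤ κ`), a valid script `s`
with `k` lines, a monomial `ψ(Z₀)⋯ψ(Z_{N-1})` and an output slot of `r` labels `W`,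
`‖kernel_r (treeFactor s ψ(Z)) (W)‖ ≤ (r!)⁻¹ (Σ_{patterns π} weight(Z, π) κ^{N − (r + 2k)}) ∫ w_s`.
[cite: BenfattoGiulianiMastropietro2006, (2.66) and (2.80)] -/
theorem norm_kernel_treeFactor_genProd_le_of_gramBounded {κ : ℝ} (hκ : 0 ≤ κ) (hGB : IsGramBounded C κ)
    (s : Script v k) (hs : s.Valid) {N : ℕ} (Z : Fin N → Γ) {r : ℕ} (W : Fin r → Γ) :
    ‖kernel 𝕜 (((Script.treeFactor (pairLap 𝕜 C cl) s : laplacianAlgebra 𝕜 C cl) : Module.End 𝕜 (GrassmannAlgebra 𝕜 Γ))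
        (genProd 𝕜 Z)) r W‖ ≤
      (((r.factorial : ℝ))⁻¹ * ∑ π ∈ patSet (scriptOps C cl W s) univ,
          patWeight Z (scriptOps C cl W s) π * κ ^ (N - (r + 2 * k))) * cubeIntegral ι ℝ (s.weight ℝ) := by
  set θ := kernelOpLM C cl (genProd 𝕜 Z) r W with hθ
  set Q : MvPolynomial ι (laplacianAlgebra 𝕜 C cl) :=
    MvPolynomial.C ((s.lines.map (pairLap 𝕜 C cl)).prod) * IsNilpotent.exp (Script.innerForm (pairLap 𝕜 C cl) s) with hQ
  -- the kernel of the formal integral is the formal integral of the kernels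
  have h1 : kernel 𝕜 (((Script.treeFactor (pairLap 𝕜 C cl) s : laplacianAlgebra 𝕜 C cl) :
      Module.End 𝕜 (GrassmannAlgebra 𝕜 Γ)) (genProd 𝕜 Z)) r W =
      cubeIntegral ι 𝕜 (MvPolynomial.map (algebraMap ℝ 𝕜) (s.weight ℝ) * coeffMap θ Q) := by
    rw [← kernelOpLM_apply, Script.treeFactor, Script.treeFactorPoly, mul_assoc, ← cubeIntegral_coeffMap, Script.weight,
      coeffMap_monomial_one_mul, show (monomial s.wExp (1 : 𝕜)) = s.weight 𝕜 from rfl, FermionicTree.weight_eq_map]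
  -- at every real parameter the kernel is a Gaussian expectation of the deleted monomial, bounded by `IsGramBounded`
  have h2 : ∀ t ∈ unitCube ι, ‖eval (fun i => ((t i : ℝ) : 𝕜)) (coeffMap θ Q)‖ ≤
      ((r.factorial : ℝ))⁻¹ * ∑ π ∈ patSet (scriptOps C cl W s) univ, patWeight Z (scriptOps C cl W s) π * κ ^ (N - (r + 2 * k)) := by
    intro t ht
    rw [eval_coeffMap, hθ, kernelOpLM_apply, hQ, coe_aeval_treeCore, kernel_prod_gaussConv_eq, norm_mul,
      norm_inv_factorial_smul_one, ← genProdOn_univ 𝕜 Z, ← Module.End.mul_apply, ← applyOps_scriptOps]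
    refine mul_le_mul_of_nonneg_left ?_ (inv_nonneg.2 (Nat.cast_nonneg _))
    have h := norm_apply_applyOps_genProdOn_le (gaussExpect 𝕜 (scriptCov C cl s t)) Z hκ
      (fun S => norm_gaussExpect_scriptCov_genProd_le_of_isGramBounded C cl hGB s hs ht (Z ∘ S.orderEmbOfFin rfl))
      (scriptOps C cl W s) univ
    rwa [Finset.card_fin, totalCost_scriptOps] at h
  rw [h1]
  exact FermionicTree.norm_cubeIntegral_map_mul_le _ _ (fun t ht => FermionicTree.eval_weight_nonneg s ht) h2

end ScriptBound

/-! ### One script, and the truncated expectation of kernel vertices -/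

section TruncatedBound

variable {𝕜 : Type*} [RCLike 𝕜] {Γ : Type*} [Fintype Γ] [DecidableEq Γ] {n : ℕ}
variable (C : Matrix Γ Γ 𝕜) (cl : Γ → Fin n) {deg : Fin n → ℕ} (K : ∀ v : Fin n, (Fin (deg v) → Γ) → 𝕜)

/-- (Twin of `sum_sum_norm_kernel_treeFactor_le` under `IsGramBounded`.) **One script** (Benfatto–Giuliani–Mastropietro 2006, (2.77) for one anchored tree): with the output slot `i`
pinned at `w` and the tree rooted at `cl w`,
`Σ_{W : W_i = w} Σ_Y ∏‖K‖ ‖kernel_r (treeFactor s ψ(flat Y)) (W)‖ ≤ (r!)⁻¹ N^{(r)} κ^{N-r-2k} (∏ N_u) (∏_{ℓ ∈ lines} α m m'_ℓ) ∫ w_s`.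
[cite: BenfattoGiulianiMastropietro2006, (2.77)] -/
theorem sum_sum_norm_kernel_treeFactor_le_of_gramBounded {κ : ℝ} (hκ : 0 ≤ κ) (hGB : IsGramBounded C κ)
    (hK : ∀ v Yv, K v Yv ≠ 0 → ∀ j, cl (Yv j) = v) (Nv : Fin n → ℝ) (hN0 : ∀ u, 0 ≤ Nv u)
    (hN : ∀ u (j : Fin (deg u)) (a : Γ), ∑ Yu ∈ univ.filter (fun Yu : Fin (deg u) → Γ => Yu j = a), ‖K u Yu‖ ≤ Nv u)
    {α : ℝ} (hα : 0 ≤ α) (hrow : ∀ ℓ X, ∑ Y, ‖typeRestrict C cl ℓ X Y‖ ≤ α) (hcol : ∀ ℓ Y, ∑ X, ‖typeRestrict C cl ℓ X Y‖ ≤ α)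
    {w : Γ} {k : ℕ} (s : Script (cl w) k) (hs : s.Valid) (hcov : univ.image s.y = univ) {r : ℕ} (i : Fin r) :
    ∑ W ∈ univ.filter (fun W : Fin r → Γ => W i = w), ∑ Ys : (∀ v, Fin (deg v) → Γ), (∏ u, ‖K u (Ys u)‖) *
        ‖kernel 𝕜 (((Script.treeFactor (pairLap 𝕜 C cl) s : laplacianAlgebra 𝕜 C cl) : Module.End 𝕜 (GrassmannAlgebra 𝕜 Γ))
          (genProd 𝕜 (flat Ys))) r W‖ ≤
      ((((r.factorial : ℝ))⁻¹ * ((∑ v, deg v).descFactorial r : ℝ)) * κ ^ ((∑ v, deg v) - (r + 2 * k)) * ∏ u, Nv u) *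
        ((s.lines.map fun ℓ => α * (pairDeg deg ℓ : ℝ)).prod * cubeIntegral (Fin n) ℝ (s.weight ℝ)) := by
  set P := patSet (scriptOps C cl (fun _ : Fin r => w) s) (univ : Finset (Fin (∑ v, deg v))) with hP
  set Iw := cubeIntegral (Fin n) ℝ (s.weight ℝ) with hIw
  set c := ((r.factorial : ℝ))⁻¹ with hc
  set e := (∑ v, deg v) - (r + 2 * k) with he
  set D := (α / 2) ^ k * ∏ u, Nv u with hD
  set preds := List.replicate r (fun _ : Fin (∑ v, deg v) × Fin (∑ v, deg v) => true) ++ s.lines.reverse.map (lapPred deg) with hpreds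
  have hIw0 : 0 ≤ Iw := cubeIntegral_nonneg _ fun t ht => FermionicTree.eval_weight_nonneg s ht
  have hc0 : 0 ≤ c := inv_nonneg.2 (Nat.cast_nonneg _)
  have hD0 : 0 ≤ D := mul_nonneg (pow_nonneg (by positivity) _) (prod_nonneg fun u _ => hN0 u)
  have hG0 : ∀ Ys : ∀ v, Fin (deg v) → Γ, 0 ≤ ∏ u, ‖K u (Ys u)‖ := fun Ys => prod_nonneg fun u _ => norm_nonneg _
  -- the `IsGramBounded` bound per output slot and label family
  have h1 : ∀ (W : Fin r → Γ) (Ys : ∀ v, Fin (deg v) → Γ), (∏ u, ‖K u (Ys u)‖) *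
      ‖kernel 𝕜 (((Script.treeFactor (pairLap 𝕜 C cl) s : laplacianAlgebra 𝕜 C cl) : Module.End 𝕜 (GrassmannAlgebra 𝕜 Γ))
        (genProd 𝕜 (flat Ys))) r W‖ ≤
      ∑ π ∈ P, (c * κ ^ e * Iw) * ((∏ u, ‖K u (Ys u)‖) * patWeight (flat Ys) (scriptOps C cl W s) π) := by
    intro W Ys
    have h := norm_kernel_treeFactor_genProd_le_of_gramBounded C cl hκ hGB s hs (flat Ys) W
    rw [patSet_scriptOps_eq C cl W (fun _ => w) s, ← hP, ← hc, ← he, ← hIw] at h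
    refine (mul_le_mul_of_nonneg_left h (hG0 Ys)).trans (le_of_eq ?_)
    rw [mul_sum, sum_mul, mul_sum]
    exact sum_congr rfl fun π _ => by ring
  -- the admissible patterns and their count
  have hcount : ((P.filter fun π => stepsOK preds π).card : ℝ) ≤
      (((∑ v, deg v).descFactorial r * (s.lines.reverse.map fun ℓ => 2 * pairDeg deg ℓ).prod : ℕ) : ℝ) := by
    set L : List (DelOp Γ 𝕜 × (Fin (∑ v, deg v) × Fin (∑ v, deg v) → Bool) × (ℕ → ℕ)) :=
      ((List.ofFn fun _ : Fin r => w).map fun X => (DelOp.ext X, (fun _ => true), id)) ++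
        (s.lines.reverse.map fun ℓ => (DelOp.lap (typeRestrict C cl ℓ), lapPred deg ℓ, fun _ => 2 * pairDeg deg ℓ)) with hL
    have hfst : L.map Prod.fst = scriptOps C cl (fun _ : Fin r => w) s := by
      rw [hL, List.map_append, List.map_map, List.map_map, scriptOps]; rfl
    have hpred : L.map (fun x => x.2.1) = preds := by
      rw [hL, hpreds, List.map_append, List.map_map, List.map_map, List.map_ofFn]
      exact congrArg₂ _ (List.ofFn_const _ _) rfl
    have hbd : L.map (fun x => (x.1, x.2.2)) = ((List.ofFn fun _ : Fin r => w).map fun X => ((DelOp.ext X : DelOp Γ 𝕜), id)) ++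
        (s.lines.reverse.map fun ℓ => ((DelOp.lap (typeRestrict C cl ℓ) : DelOp Γ 𝕜), fun _ => 2 * pairDeg deg ℓ)) := by
      rw [hL, List.map_append, List.map_map, List.map_map]; rfl
    have hB : ∀ x ∈ L, ∀ S' : Finset (Fin (∑ v, deg v)), ((DelOp.stepSet S' x.1).filter fun pq => x.2.1 pq).card ≤ x.2.2 S'.card := by
      intro x hx S'
      rw [hL, List.mem_append, List.mem_map, List.mem_map] at hx
      rcases hx with ⟨X, -, rfl⟩ | ⟨ℓ, -, rfl⟩
      · rw [filter_true_of_mem fun _ _ => rfl, DelOp.card_stepSet_ext]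
        exact le_rfl
      · exact card_filter_lapPred_le S' _ ℓ
    have h := card_filter_patSet_le L hB univ
    rw [hfst, hpred, hbd, countBound_append, countBound_exts, countBound_consts, card_univ, Fintype.card_fin] at h
    exact_mod_cast h
  -- the per-line factors
  have hprod : (s.lines.map fun ℓ => α * (pairDeg deg ℓ : ℝ)).prod =
      (α / 2) ^ k * (((s.lines.reverse.map fun ℓ => 2 * pairDeg deg ℓ).prod : ℕ) : ℝ) := by
    rw [Nat.cast_list_prod, List.map_map, List.map_reverse, List.prod_reverse,
      show (fun ℓ => α * (pairDeg deg ℓ : ℝ)) = fun ℓ => (α / 2) * ((Nat.cast : ℕ → ℝ) ∘ fun ℓ => 2 * pairDeg deg ℓ) ℓ from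
        funext fun ℓ => by simp only [Function.comp_apply, Nat.cast_mul, Nat.cast_ofNat]; ring,
      List.prod_map_mul, List.map_const', List.prod_replicate, Script.length_lines]
  calc ∑ W ∈ univ.filter (fun W : Fin r → Γ => W i = w), ∑ Ys : (∀ v, Fin (deg v) → Γ), (∏ u, ‖K u (Ys u)‖) *
          ‖kernel 𝕜 (((Script.treeFactor (pairLap 𝕜 C cl) s : laplacianAlgebra 𝕜 C cl) : Module.End 𝕜 (GrassmannAlgebra 𝕜 Γ))
            (genProd 𝕜 (flat Ys))) r W‖
      ≤ ∑ W ∈ univ.filter (fun W : Fin r → Γ => W i = w), ∑ Ys : (∀ v, Fin (deg v) → Γ),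
          ∑ π ∈ P, (c * κ ^ e * Iw) * ((∏ u, ‖K u (Ys u)‖) * patWeight (flat Ys) (scriptOps C cl W s) π) :=
        sum_le_sum fun W _ => sum_le_sum fun Ys _ => h1 W Ys
    _ = (c * κ ^ e * Iw) * ∑ π ∈ P, ∑ Ys : (∀ v, Fin (deg v) → Γ), (∏ u, ‖K u (Ys u)‖) *
          ∑ W ∈ univ.filter (fun W : Fin r → Γ => W i = w), patWeight (flat Ys) (scriptOps C cl W s) π := by
        rw [mul_sum]
        calc ∑ W ∈ univ.filter (fun W : Fin r → Γ => W i = w), ∑ Ys : (∀ v, Fin (deg v) → Γ),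
                ∑ π ∈ P, (c * κ ^ e * Iw) * ((∏ u, ‖K u (Ys u)‖) * patWeight (flat Ys) (scriptOps C cl W s) π)
            = ∑ Ys : (∀ v, Fin (deg v) → Γ), ∑ W ∈ univ.filter (fun W : Fin r → Γ => W i = w),
                ∑ π ∈ P, (c * κ ^ e * Iw) * ((∏ u, ‖K u (Ys u)‖) * patWeight (flat Ys) (scriptOps C cl W s) π) := sum_comm
          _ = ∑ Ys : (∀ v, Fin (deg v) → Γ), ∑ π ∈ P, ∑ W ∈ univ.filter (fun W : Fin r → Γ => W i = w),
                (c * κ ^ e * Iw) * ((∏ u, ‖K u (Ys u)‖) * patWeight (flat Ys) (scriptOps C cl W s) π) :=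
              sum_congr rfl fun Ys _ => sum_comm
          _ = ∑ π ∈ P, ∑ Ys : (∀ v, Fin (deg v) → Γ), ∑ W ∈ univ.filter (fun W : Fin r → Γ => W i = w),
                (c * κ ^ e * Iw) * ((∏ u, ‖K u (Ys u)‖) * patWeight (flat Ys) (scriptOps C cl W s) π) := sum_comm
          _ = _ := sum_congr rfl fun π _ => by
              rw [mul_sum]
              refine sum_congr rfl fun Ys _ => ?_
              rw [mul_sum, mul_sum]
    _ ≤ (c * κ ^ e * Iw) * ∑ π ∈ P, (if stepsOK preds π then 1 else 0) * D :=
        mul_le_mul_of_nonneg_left (sum_le_sum fun π _ => sum_kerProd_sum_patWeight_le C cl K hK Nv hN0 hN hα hrow hcol s hs hcov i π)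
          (by positivity)
    _ = (c * κ ^ e * Iw) * (((P.filter fun π => stepsOK preds π).card : ℝ) * D) := by
        rw [← sum_mul, ← sum_boole]
    _ ≤ (c * κ ^ e * Iw) * ((((∑ v, deg v).descFactorial r * (s.lines.reverse.map fun ℓ => 2 * pairDeg deg ℓ).prod : ℕ) : ℝ) * D) :=
        mul_le_mul_of_nonneg_left (mul_le_mul_of_nonneg_right hcount hD0) (by positivity)
    _ = ((c * ((∑ v, deg v).descFactorial r : ℝ)) * κ ^ e * ∏ u, Nv u) *
          ((s.lines.map fun ℓ => α * (pairDeg deg ℓ : ℝ)).prod * Iw) := by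
        rw [hprod, hD, Nat.cast_mul]
        ring

/-- (Twin of `sum_norm_kernel_ursellOf_kernelVertex_le` under `IsGramBounded`.) **The `L¹–L^∞` bound for the kernels of the truncated expectation of kernel vertices** (Benfatto–Giuliani–
Mastropietro 2006, (2.66)–(2.80); Gawȩdzki–Kupiainen 1985; Gentile–Mastropietro 2001, §4): for a charged
covariance `C` in Gram form on the mixed pairs with constant `κ` and row and column sums of `‖C|_ℓ‖` at most `α`,
even kernel vertices `M_v = Σ K_v ψ(·)` supported on their clusters with anchored `L¹` norms `≤ N_v`, and any
`λ > 0`: one output label pinned and the others summed,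
`Σ_{W : W_i = w} ‖kernel_r 𝓔ᵀ_C(M_0,…,M_{n-1}) (W)‖ ≤
  (r!)⁻¹ N^{(r)} κ^{N - r - 2(n-1)} (∏_v N_v) · λ^{-(n-1)} ∏_ℓ (1 + λ α m m'_ℓ)` — no `n!`.
[cite: BenfattoGiulianiMastropietro2006, (2.66)-(2.80)] -/
theorem sum_norm_kernel_ursellOf_kernelVertex_le_of_gramBounded {κ : ℝ} (hκ : 0 ≤ κ) (hGB : IsGramBounded C κ)
    (hm : ∀ v, Even (deg v)) (hK : ∀ v Yv, K v Yv ≠ 0 → ∀ j, cl (Yv j) = v) (Nv : Fin n → ℝ) (hN0 : ∀ u, 0 ≤ Nv u)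
    (hN : ∀ u (j : Fin (deg u)) (a : Γ), ∑ Yu ∈ univ.filter (fun Yu : Fin (deg u) → Γ => Yu j = a), ‖K u Yu‖ ≤ Nv u)
    {α : ℝ} (hα : 0 ≤ α) (hrow : ∀ ℓ X, ∑ Y, ‖typeRestrict C cl ℓ X Y‖ ≤ α) (hcol : ∀ ℓ Y, ∑ X, ‖typeRestrict C cl ℓ X Y‖ ≤ α) {lam : ℝ} (hlam : 0 < lam)
    {r : ℕ} (i : Fin r) (w : Γ) :
    ∑ W ∈ univ.filter (fun W : Fin r → Γ => W i = w),
        ‖kernel 𝕜 ((ursellOf (convMoment 𝕜 C (kernelVertex 𝕜 hm K)) univ : evenPart 𝕜 Γ) : GrassmannAlgebra 𝕜 Γ) r W‖ ≤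
      ((((r.factorial : ℝ))⁻¹ * ((∑ v, deg v).descFactorial r : ℝ)) * κ ^ ((∑ v, deg v) - (r + 2 * (n - 1))) * ∏ u, Nv u) *
        ((lam⁻¹) ^ (n - 1) * ∏ ℓ : Sym2 (Fin n), (1 + lam * (α * (pairDeg deg ℓ : ℝ)))) := by
  have hn : 0 < n := Fin.pos (cl w)
  set A := (((r.factorial : ℝ))⁻¹ * ((∑ v, deg v).descFactorial r : ℝ)) with hA
  have hA0 : 0 ≤ A := mul_nonneg (inv_nonneg.2 (Nat.cast_nonneg _)) (Nat.cast_nonneg _)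
  set y : Sym2 (Fin n) → ℝ := fun ℓ => α * (pairDeg deg ℓ : ℝ) with hy
  have hy0 : ∀ ℓ, 0 ≤ y ℓ := fun ℓ => mul_nonneg hα (Nat.cast_nonneg _)
  have hNv : 0 ≤ ∏ u, Nv u := prod_nonneg fun u _ => hN0 u
  set Wset := univ.filter (fun W : Fin r → Γ => W i = w) with hWset
  -- abbreviation for the script terms
  set T : ∀ k : ℕ, Script (cl w) k → (Fin r → Γ) → (∀ v, Fin (deg v) → Γ) → ℝ := fun k s W Ys =>
    ‖kernel 𝕜 (((Script.treeFactor (pairLap 𝕜 C cl) s : laplacianAlgebra 𝕜 C cl) : Module.End 𝕜 (GrassmannAlgebra 𝕜 Γ))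
      (genProd 𝕜 (flat Ys))) r W‖ with hT
  calc ∑ W ∈ Wset, ‖kernel 𝕜 ((ursellOf (convMoment 𝕜 C (kernelVertex 𝕜 hm K)) univ : evenPart 𝕜 Γ) : GrassmannAlgebra 𝕜 Γ) r W‖
      ≤ ∑ W ∈ Wset, ∑ Ys : (∀ v, Fin (deg v) → Γ), (∏ u, ‖K u (Ys u)‖) * ∑ k ∈ range n, ∑ s : Script (cl w) k,
          if s.Valid ∧ univ.image s.y = univ then T k s W Ys else 0 :=
        sum_le_sum fun W _ => norm_kernel_ursellOf_kernelVertex_le C cl K hm hK (cl w) r W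
    _ = ∑ k ∈ range n, ∑ s : Script (cl w) k, ∑ W ∈ Wset, ∑ Ys : (∀ v, Fin (deg v) → Γ),
          (∏ u, ‖K u (Ys u)‖) * (if s.Valid ∧ univ.image s.y = univ then T k s W Ys else 0) := by
        calc ∑ W ∈ Wset, ∑ Ys : (∀ v, Fin (deg v) → Γ), (∏ u, ‖K u (Ys u)‖) * ∑ k ∈ range n, ∑ s : Script (cl w) k,
                (if s.Valid ∧ univ.image s.y = univ then T k s W Ys else 0)
            = ∑ W ∈ Wset, ∑ Ys : (∀ v, Fin (deg v) → Γ), ∑ k ∈ range n, ∑ s : Script (cl w) k,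
                (∏ u, ‖K u (Ys u)‖) * (if s.Valid ∧ univ.image s.y = univ then T k s W Ys else 0) :=
              sum_congr rfl fun W _ => sum_congr rfl fun Ys _ => by
                rw [mul_sum]
                exact sum_congr rfl fun k _ => mul_sum _ _ _
          _ = ∑ W ∈ Wset, ∑ k ∈ range n, ∑ Ys : (∀ v, Fin (deg v) → Γ), ∑ s : Script (cl w) k,
                (∏ u, ‖K u (Ys u)‖) * (if s.Valid ∧ univ.image s.y = univ then T k s W Ys else 0) :=
              sum_congr rfl fun W _ => sum_comm
          _ = ∑ k ∈ range n, ∑ W ∈ Wset, ∑ Ys : (∀ v, Fin (deg v) → Γ), ∑ s : Script (cl w) k,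
                (∏ u, ‖K u (Ys u)‖) * (if s.Valid ∧ univ.image s.y = univ then T k s W Ys else 0) := sum_comm
          _ = ∑ k ∈ range n, ∑ W ∈ Wset, ∑ s : Script (cl w) k, ∑ Ys : (∀ v, Fin (deg v) → Γ),
                (∏ u, ‖K u (Ys u)‖) * (if s.Valid ∧ univ.image s.y = univ then T k s W Ys else 0) :=
              sum_congr rfl fun k _ => sum_congr rfl fun W _ => sum_comm
          _ = _ := sum_congr rfl fun k _ => sum_comm
    _ ≤ ∑ k ∈ range n, ∑ s : Script (cl w) k, (if s.Valid ∧ univ.image s.y = univ then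
          (A * κ ^ ((∑ v, deg v) - (r + 2 * k)) * ∏ u, Nv u) * ((s.lines.map y).prod * cubeIntegral (Fin n) ℝ (s.weight ℝ)) else 0) := by
        refine sum_le_sum fun k _ => sum_le_sum fun s _ => ?_
        split_ifs with h
        · exact sum_sum_norm_kernel_treeFactor_le_of_gramBounded C cl K hκ hGB hK Nv hN0 hN hα hrow hcol s h.1 h.2 i
        · simp
    _ = ∑ s : Script (cl w) (n - 1), (if s.Valid ∧ univ.image s.y = univ then
          (A * κ ^ ((∑ v, deg v) - (r + 2 * (n - 1))) * ∏ u, Nv u) * ((s.lines.map y).prod * cubeIntegral (Fin n) ℝ (s.weight ℝ)) else 0) := by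
        rw [sum_eq_single (n - 1)]
        · intro k _ hk
          refine sum_eq_zero fun s _ => if_neg ?_
          rintro ⟨hs, hcov⟩
          have h := Script.card_image_y s hs
          rw [hcov, card_univ, Fintype.card_fin] at h
          omega
        · intro h
          exact absurd (mem_range.2 (by omega)) h
    _ ≤ (A * κ ^ ((∑ v, deg v) - (r + 2 * (n - 1))) * ∏ u, Nv u) * ∑ s : Script (cl w) (n - 1),
          (if s.Valid then (s.lines.map y).prod * cubeIntegral (Fin n) ℝ (s.weight ℝ) else 0) := by
        rw [mul_sum]
        refine sum_le_sum fun s _ => ?_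
        have h0 := Script.prod_mul_weight_nonneg s y hy0
        by_cases hv : s.Valid
        · by_cases hc : univ.image s.y = univ
          · simp [hv, hc]
          · simp only [hv, hc, and_false, if_false, if_true]
            rw [if_pos hv] at h0
            exact mul_nonneg (mul_nonneg (mul_nonneg hA0 (pow_nonneg hκ _)) hNv) h0
        · simp [hv]
    _ ≤ (A * κ ^ ((∑ v, deg v) - (r + 2 * (n - 1))) * ∏ u, Nv u) * ((lam⁻¹) ^ (n - 1) * ∏ ℓ : Sym2 (Fin n), (1 + lam * y ℓ)) :=
        mul_le_mul_of_nonneg_left (sum_prod_mul_weight_le_of_scale y hy0 (cl w) hlam (by rw [Fintype.card_fin]; omega))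
          (mul_nonneg (mul_nonneg hA0 (pow_nonneg hκ _)) hNv)

end TruncatedBound

end Literature.MathematicalPhysics.QuantumLattice

end
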